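import Summits.CriticalPhenomena.Ising3DConformalLimit.Theses.ConformalPoissonDevice
import Summits.CriticalPhenomena.Ising3DConformalLimit.Theorems.MoebiusLimitExists.Negative.ScaleRedundant
import Summits.CriticalPhenomena.Ising3DConformalLimit.Theorems.MoebiusLimitExists.Negative.FreeTranslations
import Literature.Probability.LatticeModels.PoissonDelaunayIsing
import Literature.Probability.LatticeModels.AnnealedDeviceCorr
import Summits.CriticalPhenomena.Ising3DConformalLimit.Theorems.ConformalPoissonDeviceDeviceWeylUniversalityStubLimitZero
import Summits.CriticalPhenomena.Ising3DConformalLimit.Theorems.ConformalPoissonDeviceDeviceWeylUniversalityStubLimitOdd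
import Summits.CriticalPhenomena.Ising3DConformalLimit.Theorems.ConformalPoissonDeviceDeviceWeylUniversalityStubDeviceZero
import Summits.CriticalPhenomena.Ising3DConformalLimit.Theorems.ConformalPoissonDeviceDeviceWeylUniversalityStubDeviceOdd
import HarnessLib

/-!
# Crux `ConformalPoissonDevice.DeviceWeylUniversality` (stmt-CriticalPhenomena-4722) — the reduction theorem
# of line `birth`: the crux from ℤ³ ↔ Poisson–Delaunay universality (U'') and the conformal-density Weyl law (W'')

Route `ConformalPoissonDevice`, sub-problem `Ising3DConformalLimit`. This file makes the END STATE of the line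
`birth` (skeleton `Cruxes/DeviceWeylUniversality/Lines/birth.lean`, rev L6) an importable, sorry-free theorem
of the tree: `deviceWeylUniversality_of_flatUniversality_of_weylLaw : U'' → W'' → DeviceWeylUniversality`,
where the two hypotheses are spelled out verbatim (they are the registered open stubs
`stub_flatUniversalityEven`, `stub_deviceWeylLawEven` of the crux, open problems in print):

* U'' (ℤ³ ↔ homogeneous Poisson–Delaunay Ising universality, even `n ≥ 2`): for every pointwise scaling
  limit `S` of the critical `ℤ³` correlators (`ρ > 0` on `(0,1]`, non-degenerate two-point function) there
  are `β > 0` and constants `c_N` with `c_N^n · pdCorr (N • vol) β n → S n` locally uniformly on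
  `NonCoincident 3 n` for every even `n ≥ 2` (Janke–Villanova 2002 numerics; no proof in print).
* W'' (Weyl law under the conformal change of density `N ↦ N(1+‖z‖²)⁻³`, even `n ≥ 2`): a normalised,
  non-degenerate, translation-invariant, `Δ`-scale-covariant flat continuum limit `T` of the homogeneous
  Poisson–Delaunay Ising model at coupling `β` is transported to the device's Poisson laws with exactly the
  Weyl factor `∏ᵢ (1+‖xᵢ‖²)^Δ`, along polynomially bounded constants (Cardy 1985 heuristics; no proof).

Everything else the crux needs is PROVED and imported: `n = 0` (`stub_limitZero`, `stub_deviceZero`),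
odd `n` (`stub_limitOdd` — odd critical `ℤ³` correlators vanish since `m*(β_c) = 0`, ADS 2015 — and
`stub_deviceOdd` — odd device correlators are the void probability `e^{-Nπ²/4}`), and the structure of any
`ℤ³` limit in scope (`exists_scaleCovariant_normalised`, `isTranslationInvariant_normalised_of_limit`:
the normalised limit is scale covariant with some `Δ ∈ [1/2,1]`, translation invariant, non-degenerate).
So `Δ` is OUTPUT, as the route header demands, and the crux is a theorem of the tree modulo exactly the two
named conjectures U'', W'' — the planner's conditional bridge is `deviceWeylUniversality_of_… hU hW`.

No new definitions; helper for item stmt-CriticalPhenomena-4722 (does not close it).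
-/

noncomputable section

namespace Summit.CriticalPhenomena.Ising3DConformalLimit.Theorems.DeviceWeylUniversality

open MeasureTheory Filter Set
open Literature.Analysis.FunctionSpaces Literature.Probability.LatticeModels
open Summit.CriticalPhenomena.Ising3DConformalLimit.Theses
open Summit.CriticalPhenomena.Ising3DConformalLimit.MoebiusLimitExistsNegative

namespace Reduction

open Classical in
/-- **What the tree gives about any `ℤ³` limit in the scope of the crux**: the normalised family
`S̃ = S·𝟙_{NonCoincident}` is scale covariant with some `Δ ∈ [1/2, 1]` (`exists_scaleCovariant_normalised`:
Simon–Lieb lower / infrared upper two-point bounds + Cauchy's equation), translation invariant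
(`isTranslationInvariant_normalised_of_limit`), non-degenerate, normalised, and agrees with `S` on
`NonCoincident`. [folklore] -/
theorem exists_normalised_target {ρ : ℝ → ℝ} {S : CorrFamily 3}
    (hρ : ∀ δ ∈ Set.Ioc (0:ℝ) 1, 0 < ρ δ) (hlim : HasPointwiseScalingLimit (criticalCorr 3) ρ S)
    (hnd : IsNondegenerateTwoPoint S) :
    ∃ (T : CorrFamily 3) (Δ : ℝ), Δ ∈ Set.Icc (1 / 2 : ℝ) 1 ∧ IsScaleCovariant Δ T ∧
      IsTranslationInvariant T ∧ IsNondegenerateTwoPoint T ∧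
      (∀ (n : ℕ) (z : Fin n → EuclideanSpace ℝ (Fin 3)), z ∉ NonCoincident 3 n → T n z = 0) ∧
      (∀ (n : ℕ), ∀ x ∈ NonCoincident 3 n, T n x = S n x) := by
  obtain ⟨Δ, hΔ, hsc⟩ := exists_scaleCovariant_normalised hρ hlim hnd
  exact ⟨_, Δ, hΔ, hsc, isTranslationInvariant_normalised_of_limit hlim, normalised_nondeg hnd,
    fun n z hz => if_neg hz, fun n x hx => if_pos hx⟩

/-- A sequence of functions that agrees with its limit on `s` at every index converges locally uniformly
on `s`. Used for the `n = 0` instance of the crux, where both sides are the constant `1`. [folklore] -/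
theorem tendstoLocallyUniformlyOn_of_eqOn {X : Type*} [TopologicalSpace X] {F : ℕ → X → ℝ}
    {f : X → ℝ} {s : Set X} (h : ∀ N, ∀ x ∈ s, F N x = f x) :
    TendstoLocallyUniformlyOn F f atTop s := by
  have hu : TendstoUniformlyOn F f atTop s := fun u hu =>
    Filter.Eventually.of_forall fun N x hx => by
      rw [h N x hx]
      exact refl_mem_uniformity hu
  exact hu.tendstoLocallyUniformlyOn

end Reduction

open Reduction in
/-- **Reduction theorem of line `birth` (crux `DeviceWeylUniversality` ⇐ U'' ∧ W'').** If
(U'') every non-degenerate pointwise scaling limit `S` of the critical `ℤ³` correlators is, for even `n ≥ 2`,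
the locally uniform limit on `NonCoincident` of `c_N^n · pdCorr (N • vol) β n` for some `β > 0`, `c`, and
(W'') every normalised, non-degenerate, translation-invariant, `Δ`-scale-covariant flat limit `T` of the
homogeneous Poisson–Delaunay Ising model at `β` is carried to the Poisson laws of intensity `N(1+‖z‖²)⁻³dz`
with the Weyl factor `∏ᵢ (1+‖xᵢ‖²)^Δ` along polynomially bounded constants (even `n ≥ 2`), then the crux
holds: U'' gives `β, c` and flat convergence to `S`, hence to the normalised `S̃` (tree:
`exists_normalised_target`, `Δ ∈ [1/2,1]`); W'' gives `c'` and the twisted even-`n` convergence of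
`annealedDeviceCorr (P N) β`, which IS the crux's `F` (`hF` + `rfl`); `n = 0` is `1 → 1`
(`stub_deviceZero`, `stub_limitZero`); odd `n` is `c'^n e^{-Nπ²/4} → 0` (`stub_deviceOdd`) against the
target `0` (`stub_limitOdd`). Both hypotheses are open problems in print (Janke–Villanova 2002; Cardy 1985).
[folklore] -/
theorem deviceWeylUniversality_of_flatUniversality_of_weylLaw :
    (∀ (ρ : ℝ → ℝ) (S : Literature.Probability.LatticeModels.CorrFamily 3),
      (∀ δ ∈ Set.Ioc (0:ℝ) 1, 0 < ρ δ)
      → Literature.Probability.LatticeModels.HasPointwiseScalingLimit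
          (Literature.Probability.LatticeModels.criticalCorr 3) ρ S
      → Literature.Probability.LatticeModels.IsNondegenerateTwoPoint S
      → ∃ (β : ℝ) (c : ℕ → ℝ), 0 < β ∧ ∀ n : ℕ, Even n → n ≠ 0 → TendstoLocallyUniformlyOn
          (fun (N : ℕ) (x : Fin n → EuclideanSpace ℝ (Fin 3)) => c N ^ n *
            Literature.Probability.LatticeModels.pdCorr
              ((N : ENNReal) • (MeasureTheory.volume : MeasureTheory.Measure (EuclideanSpace ℝ (Fin 3))))
              β n x)
          (S n) Filter.atTop (Literature.Probability.LatticeModels.NonCoincident 3 n))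
    → (∀ (P : ℕ → MeasureTheory.Measure
        (Literature.Analysis.FunctionSpaces.PointConfig (EuclideanSpace ℝ (Fin 3)))),
      (∀ N : ℕ, Literature.Analysis.FunctionSpaces.IsPoissonPointProcess ((N : ENNReal) •
        (MeasureTheory.volume : MeasureTheory.Measure (EuclideanSpace ℝ (Fin 3))).withDensity
          (fun z => ENNReal.ofReal ((1 + ‖z‖ ^ 2) ^ (-(3:ℝ))))) (P N))
      → ∀ (β Δ : ℝ) (c : ℕ → ℝ) (T : Literature.Probability.LatticeModels.CorrFamily 3), 0 < β → 0 < Δ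
      → (∀ (n : ℕ) (z : Fin n → EuclideanSpace ℝ (Fin 3)),
          z ∉ Literature.Probability.LatticeModels.NonCoincident 3 n → T n z = 0)
      → Literature.Probability.LatticeModels.IsNondegenerateTwoPoint T
      → Literature.Probability.LatticeModels.IsTranslationInvariant T
      → Literature.Probability.LatticeModels.IsScaleCovariant Δ T
      → (∀ n : ℕ, Even n → n ≠ 0 → TendstoLocallyUniformlyOn
          (fun (N : ℕ) (x : Fin n → EuclideanSpace ℝ (Fin 3)) => c N ^ n *
            Literature.Probability.LatticeModels.pdCorr
              ((N : ENNReal) • (MeasureTheory.volume : MeasureTheory.Measure (EuclideanSpace ℝ (Fin 3))))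
              β n x)
          (T n) Filter.atTop (Literature.Probability.LatticeModels.NonCoincident 3 n))
      → ∃ c' : ℕ → ℝ, (∃ K : ℕ, ∀ N : ℕ, |c' N| ≤ ((N : ℝ) + 1) ^ K) ∧
          ∀ n : ℕ, Even n → n ≠ 0 → TendstoLocallyUniformlyOn
          (fun (N : ℕ) (x : Fin n → EuclideanSpace ℝ (Fin 3)) => c' N ^ n *
            Literature.Probability.LatticeModels.annealedDeviceCorr (P N) β n x)
          (fun x => (∏ i, (1 + ‖x i‖ ^ 2) ^ Δ) * T n x) Filter.atTop
          (Literature.Probability.LatticeModels.NonCoincident 3 n))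
    → Summit.CriticalPhenomena.Ising3DConformalLimit.Theses.ConformalPoissonDevice.DeviceWeylUniversality := by
  intro hU hW P F hP hF ρ S hρ hlim hnd
  -- U'': the flat Poisson–Delaunay model at some `β > 0` converges to `S` along `c`, even `n ≥ 2`
  obtain ⟨β, c, hβ, hflat⟩ := hU ρ S hρ hlim hnd
  -- TREE: the normalised target and its scaling dimension `Δ ∈ [1/2, 1]`
  obtain ⟨T, Δ, hΔ, hsc, htr, hndT, hnormT, hTS⟩ := exists_normalised_target hρ hlim hnd
  have hΔpos : 0 < Δ := lt_of_lt_of_le one_half_pos hΔ.1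
  -- the flat model converges to `T` as well (`T = S` on `NonCoincident`)
  have hflatT : ∀ n : ℕ, Even n → n ≠ 0 → TendstoLocallyUniformlyOn
      (fun (N : ℕ) (x : Fin n → EuclideanSpace ℝ (Fin 3)) => c N ^ n *
        pdCorr ((N : ENNReal) • (volume : Measure (EuclideanSpace ℝ (Fin 3)))) β n x)
      (T n) atTop (NonCoincident 3 n) :=
    fun n hn hn0 => (hflat n hn hn0).congr_right fun x hx => (hTS n x hx).symm
  -- W'': the Weyl law for the device at the same `β`, with this `Δ`, polynomially bounded `c'`
  obtain ⟨c', ⟨K, hK⟩, hdev⟩ := hW P hP β Δ c T hβ hΔpos hnormT hndT htr hsc hflatT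
  refine ⟨β, Δ, c', hβ, hΔpos, fun n => ?_⟩
  -- the crux's `F` IS `annealedDeviceCorr` (by `hF` + `rfl`)
  have hFeq : ∀ (N : ℕ) (x : Fin n → EuclideanSpace ℝ (Fin 3)),
      F N β n x = annealedDeviceCorr (P N) β n x := fun N x => by
    rw [hF N β n x]
    rfl
  rcases Nat.even_or_odd n with hn | hn
  · rcases eq_or_ne n 0 with rfl | hn0
    · -- n = 0: both sides are the constant `1`
      refine tendstoLocallyUniformlyOn_of_eqOn fun N x _ => ?_
      rw [pow_zero, one_mul, hFeq, stub_deviceZero P hP β N x, stub_limitZero ρ S hlim x,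
        Fin.prod_univ_zero, one_mul]
    · -- even n ≥ 2: W'', moved to `F` and back to `S`
      have hdevF : TendstoLocallyUniformlyOn
          (fun (N : ℕ) (x : Fin n → EuclideanSpace ℝ (Fin 3)) => c' N ^ n * F N β n x)
          (fun x => (∏ i, (1 + ‖x i‖ ^ 2) ^ Δ) * T n x) atTop (NonCoincident 3 n) := by
        refine (hdev n hn hn0).congr fun N x _ => ?_
        show c' N ^ n * annealedDeviceCorr (P N) β n x = c' N ^ n * F N β n x
        rw [hFeq N x]
      exact hdevF.congr_right fun x hx => by
        show (∏ i, (1 + ‖x i‖ ^ 2) ^ Δ) * T n x = (∏ i, (1 + ‖x i‖ ^ 2) ^ Δ) * S n x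
        rw [hTS n x hx]
  · -- odd n: `c'_N^n · F → 0` (stub_deviceOdd with the bound `K`); the target vanishes (stub_limitOdd)
    have hdevF : TendstoLocallyUniformlyOn
        (fun (N : ℕ) (x : Fin n → EuclideanSpace ℝ (Fin 3)) => c' N ^ n * F N β n x)
        (fun _ => 0) atTop (NonCoincident 3 n) := by
      refine (stub_deviceOdd P hP β c' K hK n hn).congr fun N x _ => ?_
      show c' N ^ n * annealedDeviceCorr (P N) β n x = c' N ^ n * F N β n x
      rw [hFeq N x]
    exact hdevF.congr_right fun x hx => by
      show (0 : ℝ) = (∏ i, (1 + ‖x i‖ ^ 2) ^ Δ) * S n x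
      rw [stub_limitOdd ρ S hlim n hn x hx, mul_zero]

end Summit.CriticalPhenomena.Ising3DConformalLimit.Theorems.DeviceWeylUniversality

end
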